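import Summits.BirchSwinnertonDyer.BirchSwinnertonDyer.Theses.GenusKolyvaginAtTwo
import Summits.BirchSwinnertonDyer.BirchSwinnertonDyer.Theorems.GenusKolyvaginAtTwoMinimalTwinBSDTwoOddCutFrobeniusFrameDoor
import Summits.BirchSwinnertonDyer.BirchSwinnertonDyer.Theorems.GenusKolyvaginAtTwoMinimalTwinBSDTwoAnalyticTwin
import Summits.BirchSwinnertonDyer.BirchSwinnertonDyer.Theorems.GenusKolyvaginAtTwoMinimalTwinBSDTwoOddManinOfCDT
import HarnessLib

/-!
# Route `GenusKolyvaginAtTwo`, crux U₂ `MinimalTwinBSDTwo` (stmt-BirchSwinnertonDyer-22985), LINE 23 «twin_swap» — CENSUS CERTIFICATE OF THE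
# SKELETON OF RECORD v2.14 (`Cruxes/MinimalTwinBSDTwo/Lines/twin_swap.lean`, sha16 a94f92af6f09d3f2), STATED THEOREMS-SIDE (no `sorry`, citable):
# U₂ BY NAME ⟸ WALL row 1 (items BY NAME) + PRINT×10 (named facts) + Q2 (item BY NAME) + NVFROB + WITNESS_{dc,≥2} + KEX|off (the three research
# leaves, verbatim); and conversely KEX|off ⟸ U₂ + WALL row 1 + PRINT×4 (the off-cut leaf is U₂-NECESSARY: no overreach)

Seat `bsd-line-gk2-p2` g38 (PROVER seat 2/3, cell `bsd-f1-sign2`, LINE 23 holder), `--supports stmt-BirchSwinnertonDyer-22985 --as helper`; written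
under D-0182 (BSD ladder wind-down: finish-and-book, STATE AT FREEZE).  THEOREMS ONLY (no definition, no named fact, no `sorry`); standard axioms.
**BSD is NOT proved by this file; U₂ is NOT proved (it is the CONCLUSION of a conditional theorem three of whose hypotheses are OPEN research
statements); Manin's conjecture is not claimed; no item is closed.**

WHY THIS FILE.  The line's composition lives in a Cruxes workfile that carries the stubs' `sorry`s and cannot be imported.  At the D-0182 freeze the
state of LINE 23 is booked here as kernel theorems over tree declarations only, so that a restart can CITE the exact residue:
* §1 `bsdp_offCut_of_rankZero_of_halves_of_facts` — OFF the odd habitat cut, one curve at a time: S1′ (rank-0 BSD₂) + DIV′|off + NDIV′|off + PRINT×6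
  ⟹ `BSD₂(W)` (v2.5's Friedberg–Hoffstein road: the exact `2`-depth `M₀` of the non-torsion `P(1)` exists, the two halves give
  `#Ш(W/K)[2^∞]·2^{2(v₂ c + v₂ C(W))} = 2^{2M₀}`, and `AnalyticTwin.swappedPairDescentAtTwo_shaDepth_anyTwin_of_facts` descends from the twin).
* §2 ★ `minimalTwinBSDTwo_of_wallItems_of_printFacts_of_kolyvaginRelation_of_leaves` — **the item `GenusKolyvaginAtTwo.MinimalTwinBSDTwo` BY NAME**
  from: the four WALL row 1 items of route ByReductionTypeAtTwo BY NAME (stmt-19095–19098), the ten PRINT named facts of v2.14 (GZ, GZK, modularity,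
  Milne, BCDT datum, Friedberg–Hoffstein, Abbes–Ullmo, Česnavičius, Mazur, `exists_isNewformOf`), Q2 = item stmt-24880 `KolyvaginRelationAtTwo` BY
  NAME, and the three research leaves NVFROB · WITNESS_{dc,≥2} · KEX|off = DIV′|off ∧ NDIV′|off with their v2.14 texts VERBATIM (unfolded).  ON the
  cut this is `TwinAnnihilation.minimalTwinBSDTwo_onOddCut_of_wall_of_frobeniusFrameDoorSupply_of_witnessSupply_of_facts` (p818537) whose Manin
  clause (i) is DISCHARGED by `OddManin.oddCutManinResidue_of_printedFacts` (p829418; from the closed crux stmt-22967 `ManinLocalTwoThree.ManinOddAtFour`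
  — status of record: PROVED AS TYPED, UDC-dependent, audit (P†) pending; this theorem inherits that status through the import); OFF the cut it is §1.
* §3 `heegnerIndexOffCut_of_minimalTwinBSDTwo_of_rankZero_of_facts` — **KEX|off is U₂-NECESSARY**: PRINT×4 + S1′ + U₂ ⟹ DIV′|off ∧ NDIV′|off
  (`AnalyticTwin.kexAny_of_minimalTwinBSDTwo_of_wall_of_facts` + uniqueness of the exact `2`-depth), so the off-cut leaf is not stronger than the crux.
  (NVFROB's door clause is BSD-necessary by `doorClause_of_bsdp_pair`, p818043, and granted BSD NVFROB is its analytic half, `…FrobeniusFrameDoorOfBSD`;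
  WITNESS_{dc,≥2} = Kolyvagin's conjecture at `2` at depth `≥ 2` is the one leaf NOT known to follow from BSD — W. Zhang's converse is `p ≥ 5`.)

HONEST FRAMING.  Everything is CONDITIONAL on the displayed hypotheses.  OPEN among them: the four WALL items (rank-0 BSD₂ by reduction type), Q2 as an
item (McCallum Prop. 4.4 at `2`, typed open), NVFROB (quadratic-twist non-vanishing inside a Chebotarev class + Kolyvagin–Zhang `2`-primitivity at door-open
frames), WITNESS_{dc,≥2} (Kolyvagin's conjecture at `2`), KEX|off (the `2`-primary Gross–Zagier index relation off the cut).  The PRINT facts are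
statements of published theorems (named `def … : Prop` of the tree, taken as hypotheses).  Nothing beyond print is claimed; BSD is proved for no curve.

References: [GrossZagier1986] I.(6.3), V.§2 (2.2); [Kolyvagin1989Izv] Thm. A; [McCallumLMS1991] §5 Lemma 5.1, Prop. 4.4; [FriedbergHoffstein1995] Thm. B;
[Milne1972ArithmeticAV] §1 Thm. 1; [BCDTJAMS2001] Thm. A; [AbbesUllmo1996] Thm. A; [Cesnavicius2018] Thm. 1.2; [Mazur1978] Cor. 4.1;
[KrizLi2019] Def. 4.1, Thm. 4.3; [WZhang2014] Thm. 1.1.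
-/

set_option autoImplicit false
set_option linter.dupNamespace false -- `Summit.<P>.<Sub>` repeats `BirchSwinnertonDyer` (D-0017)

noncomputable section

open scoped Classical NumberField

open Summit.BirchSwinnertonDyer.BirchSwinnertonDyer.Theses.GenusKolyvaginAtTwo
  (MinimalTwinBSDTwo KolyvaginRelationAtTwo GrossZagierAllLevels MultPublishedInputsAtTwo EntireLFunctionRat MilneAnyModel)
open Summit.BirchSwinnertonDyer.BirchSwinnertonDyer.Theses.ByReductionTypeAtTwo
  (GoodOrdinaryRankZeroAtTwo MultiplicativeRankZeroAtTwo SupersingularRankZeroAtTwo AdditiveRankZeroAtTwo)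
open WeierstrassCurve NumberField Literature.NumberTheory.EllipticCurves Literature.NumberTheory.EllipticCurves.ModularForms
open Summit.BirchSwinnertonDyer.BirchSwinnertonDyer.Theorems
open Summit.BirchSwinnertonDyer.BirchSwinnertonDyer.Theorems.GenusExact.TwinSwap
open Summit.BirchSwinnertonDyer.BirchSwinnertonDyer.Theorems.GenusExact.TwinSwap.AnalyticTwin
  (swappedPairDescentAtTwo_shaDepth_anyTwin_of_facts kexAny_of_minimalTwinBSDTwo_of_wall_of_facts)
open Summit.BirchSwinnertonDyer.BirchSwinnertonDyer.Theorems.GenusExact.TwinSwap.TwinAnnihilation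
  (minimalTwinBSDTwo_onOddCut_of_wall_of_frobeniusFrameDoorSupply_of_witnessSupply_of_facts)
open Summit.BirchSwinnertonDyer.BirchSwinnertonDyer.Theorems.GenusExact.TwinSwap.Ledger.Line25
  (exists_kolyvaginHeegnerData_one_of_nonempty_modularParametrizationData not_isOfFinAddOrder_derivedPoint_one_of_rankOne_of_lValue_ne_zero)
open Summit.BirchSwinnertonDyer.BirchSwinnertonDyer.Theorems.KolyvaginAtTwo (exists_exactTwoDepth)
open Literature.NumberTheory.QuadraticFields.Quadratic (ncard_primesOver_two_eq_two_iff)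

namespace Summit.BirchSwinnertonDyer.BirchSwinnertonDyer.Theorems.GenusExact.TwinSwap.FreezeCensus

/-! ## §1 Off the cut, one curve at a time -/

/-- **OFF THE CUT: v2.5's road, one curve at a time.**  For a single non-CM globally minimal `W` of analytic rank `1` with `#Sel₂(W) = 2` OFF the odd
habitat cut (`¬ (C(W) odd ∧ ρ_{W,2^n} onto ∀ n ≥ 1 ∧ an odd multiplicative prime)`): S1′ (rank-`0` BSD₂ for every non-CM globally minimal curve) +
DIV′|off + NDIV′|off (the two halves of the `2`-primary Gross–Zagier index relation, restricted off the cut, v2.14 texts verbatim) + PRINT×6 ⟹ `BSD₂(W)`: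
Friedberg–Hoffstein gives a Heegner field `K` with `2` split and `L(W^{(d_K)},1) ≠ 0`; the exact `2`-depth `M₀` of the non-torsion `P(1)` exists; the two
halves give `#Ш(W/K)[2^∞]·2^{2(v₂ c + v₂ C(W))} = 2^{2M₀}` (`Nat.dvd_antisymm`); the twin is non-CM of analytic rank `0`, so S1′ pays `BSD₂` of a
globally minimal model of it, and `swappedPairDescentAtTwo_shaDepth_anyTwin_of_facts` descends.  CONDITIONAL; proves nothing about BSD.
[cite: FriedbergHoffstein1995, Thm. B] [cite: GrossZagier1986, V.§2 (2.2)] [cite: Milne1972ArithmeticAV, §1 Thm. 1] -/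
theorem bsdp_offCut_of_rankZero_of_halves_of_facts
    (hS1 : ∀ (W : WeierstrassCurve ℚ) [W.IsElliptic] [W.IsGloballyMinimal], ¬ W.HasCM → W.analyticRank = 0 → BSDp W 2)
    (hU : ∀ (W : WeierstrassCurve ℚ) [W.IsElliptic] [W.IsGloballyMinimal] [NeZero (W.conductorNorm ℤ)],
      ¬ W.HasCM → W.analyticRank = 1 → Nat.card (W.selmerGroup 2) = 2 →
      ¬ (Odd W.tamagawaProduct ∧ (∀ n : ℕ, 0 < n → W.HasSurjectiveModNGaloisRep ((2 : ℤ) ^ n)) ∧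
        ∃ v : IsDedekindDomain.HeightOneSpectrum (𝓞 ℚ), ((2 : ℕ) : 𝓞 ℚ) ∉ v.asIdeal ∧ ((W.conductorNorm ℤ : ℕ) : 𝓞 ℚ) ∈ v.asIdeal ∧
          W.HasMultiplicativeReductionAt v) →
      ∀ (K : Type) [Field K] [NumberField K], IsImaginaryQuadratic K →
        Odd (NumberField.discr K) → NumberField.discr K ≠ -3 → SatisfiesHeegnerHypothesis (W.conductorNorm ℤ) K →
        ((Ideal.span {(2 : ℤ)}).primesOver (𝓞 K)).ncard = 2 →
        ∀ (Wd : WeierstrassCurve ℚ) [Wd.IsElliptic] [Wd.IsGloballyMinimal],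
          (∃ C : VariableChange ℚ, C • W.quadraticTwist (NumberField.discr K : ℚ) = Wd) →
        (W.quadraticTwist (NumberField.discr K : ℚ)).entireLFunction 1 ≠ 0 →
        ∀ (Dt : ModularParametrizationData W (W.conductorNorm ℤ)) (β : ℤ) (ι : K →+* ℂ) (d₁ : KolyvaginHeegnerData Dt β ι 1) (M₀ : ℕ),
          (∃ Q : (W.baseChange (ringClassField K ι 1)).toAffine.Point, ((2 ^ M₀ : ℕ) : ℤ) • Q = d₁.derivedPoint) →
          (¬ ∃ Q : (W.baseChange (ringClassField K ι 1)).toAffine.Point, ((2 ^ (M₀ + 1) : ℕ) : ℤ) • Q = d₁.derivedPoint) →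
            Nat.card (AddCommGroup.primaryComponent (W.baseChange K).sha 2) *
                2 ^ (2 * (padicValInt 2 Dt.c + padicValNat 2 W.tamagawaProduct)) ∣ 2 ^ (2 * M₀))
    (hL : ∀ (W : WeierstrassCurve ℚ) [W.IsElliptic] [W.IsGloballyMinimal] [NeZero (W.conductorNorm ℤ)],
      ¬ W.HasCM → W.analyticRank = 1 → Nat.card (W.selmerGroup 2) = 2 →
      ¬ (Odd W.tamagawaProduct ∧ (∀ n : ℕ, 0 < n → W.HasSurjectiveModNGaloisRep ((2 : ℤ) ^ n)) ∧
        ∃ v : IsDedekindDomain.HeightOneSpectrum (𝓞 ℚ), ((2 : ℕ) : 𝓞 ℚ) ∉ v.asIdeal ∧ ((W.conductorNorm ℤ : ℕ) : 𝓞 ℚ) ∈ v.asIdeal ∧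
          W.HasMultiplicativeReductionAt v) →
      ∀ (K : Type) [Field K] [NumberField K], IsImaginaryQuadratic K →
        Odd (NumberField.discr K) → NumberField.discr K ≠ -3 → SatisfiesHeegnerHypothesis (W.conductorNorm ℤ) K →
        ((Ideal.span {(2 : ℤ)}).primesOver (𝓞 K)).ncard = 2 →
        ∀ (Wd : WeierstrassCurve ℚ) [Wd.IsElliptic] [Wd.IsGloballyMinimal],
          (∃ C : VariableChange ℚ, C • W.quadraticTwist (NumberField.discr K : ℚ) = Wd) →
        (W.quadraticTwist (NumberField.discr K : ℚ)).entireLFunction 1 ≠ 0 →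
        ∀ (Dt : ModularParametrizationData W (W.conductorNorm ℤ)) (β : ℤ) (ι : K →+* ℂ) (d₁ : KolyvaginHeegnerData Dt β ι 1) (M₀ : ℕ),
          (∃ Q : (W.baseChange (ringClassField K ι 1)).toAffine.Point, ((2 ^ M₀ : ℕ) : ℤ) • Q = d₁.derivedPoint) →
          (¬ ∃ Q : (W.baseChange (ringClassField K ι 1)).toAffine.Point, ((2 ^ (M₀ + 1) : ℕ) : ℤ) • Q = d₁.derivedPoint) →
            2 ^ (2 * M₀) ∣ Nat.card (AddCommGroup.primaryComponent (W.baseChange K).sha 2) *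
                2 ^ (2 * (padicValInt 2 Dt.c + padicValNat 2 W.tamagawaProduct)))
    (hGZ : GrossZagierAllLevels) (hGZK : MultPublishedInputsAtTwo) (hmod : EntireLFunctionRat) (hMilneC : MilneAnyModel)
    (hMP : nonempty_modularParametrizationData) (hFH : friedbergHoffstein_exists_heegnerField_split_twist_ne_zero)
    (W : WeierstrassCurve ℚ) [W.IsElliptic] [W.IsGloballyMinimal] (hcm : ¬ W.HasCM) (hr : W.analyticRank = 1)
    (hSel : Nat.card (W.selmerGroup 2) = 2)
    (hoff : ¬ (Odd W.tamagawaProduct ∧ (∀ n : ℕ, 0 < n → W.HasSurjectiveModNGaloisRep ((2 : ℤ) ^ n)) ∧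
      ∃ v : IsDedekindDomain.HeightOneSpectrum (𝓞 ℚ), ((2 : ℕ) : 𝓞 ℚ) ∉ v.asIdeal ∧ ((W.conductorNorm ℤ : ℕ) : 𝓞 ℚ) ∈ v.asIdeal ∧
        W.HasMultiplicativeReductionAt v)) : BSDp W 2 := by
  haveI : NeZero (W.conductorNorm ℤ) := ⟨(W.conductorNorm_pos_holds).ne'⟩
  obtain ⟨Dt₀⟩ := hMP W
  have hw : W.rootNumber = -1 := by
    rcases Literature.NumberTheory.EllipticCurves.rootNumber_eq_one_or_eq_neg_one W with h | h
    · exfalso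
      have hev : Even W.analyticRank :=
        (Literature.Barriers.BirchSwinnertonDyer.even_analyticRank_iff_of_isNewformOf_conductorLevel Dt₀.isNewformOf).mpr h
      rw [hr] at hev
      exact Nat.not_even_one hev
    · exact h
  -- Friedberg–Hoffstein: a Heegner field with `2` split, `|d_K| > 4`, `L(W^{(d_K)},1) ≠ 0`
  obtain ⟨K, _, _, hK, hB, hH, h2H, hLv⟩ := hFH W hw 2 Nat.prime_two 4
  have h2 : Module.finrank ℚ K = 2 := hK.1
  have h2K : ((Ideal.span {(2 : ℤ)}).primesOver (𝓞 K)).ncard = 2 := by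
    simpa using h2H 2 Nat.prime_two (dvd_refl 2)
  have hodd : Odd (NumberField.discr K) := by
    have h8 := (ncard_primesOver_two_eq_two_iff (K := K) h2).mp h2K
    rw [Int.odd_iff]; omega
  have h3 : NumberField.discr K ≠ -3 := by
    intro h; rw [h] at hB; simp at hB
  have hD0 : (NumberField.discr K : ℚ) ≠ 0 := by exact_mod_cast NumberField.discr_ne_zero K
  haveI := W.isElliptic_quadraticTwist hD0
  obtain ⟨Cd, hmin⟩ := hasGlobalMinimalModel_rat_holds (W.quadraticTwist (NumberField.discr K : ℚ))
  haveI := hmin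
  -- a conductor-1 datum and its Heegner point of infinite order
  obtain ⟨Dt, β, ι, d₁, hc0⟩ := exists_kolyvaginHeegnerData_one_of_nonempty_modularParametrizationData hMP W K hK hH
  have hy : ¬ IsOfFinAddOrder d₁.derivedPoint :=
    not_isOfFinAddOrder_derivedPoint_one_of_rankOne_of_lValue_ne_zero hmod W K (hGZ _ W K) hK hH hr hLv d₁
  -- the exact `2`-depth of `P(1)` exists (Mordell–Weil over `K[1]` + Krull)
  haveI := (finiteDimensional_and_isGalois_ringClassField hK ι one_ne_zero).1
  haveI : NumberField (ringClassField K ι 1) := NumberField.of_module_finite K _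
  haveI : (W.baseChange (ringClassField K ι 1)).IsElliptic := by rw [baseChange]; infer_instance
  haveI : Module.Finite ℤ (W.baseChange (ringClassField K ι 1)).toAffine.Point := by
    convert (W.baseChange (ringClassField K ι 1)).module_finite_point_holds
  obtain ⟨M₀, hdiv, hndiv⟩ := exists_exactTwoDepth
    (A := (W.baseChange (ringClassField K ι 1)).toAffine.Point) (y := d₁.derivedPoint) (by convert hy)
  -- the two restricted halves at this frame give the exactness
  have hsha : Nat.card (AddCommGroup.primaryComponent (W.baseChange K).sha 2) *
      2 ^ (2 * (padicValInt 2 Dt.c + padicValNat 2 W.tamagawaProduct)) = 2 ^ (2 * M₀) :=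
    Nat.dvd_antisymm
      (hU W hcm hr hSel hoff K hK hodd h3 hH h2K (Cd • W.quadraticTwist (NumberField.discr K : ℚ)) ⟨Cd, rfl⟩ hLv Dt β ι d₁ M₀ hdiv hndiv)
      (hL W hcm hr hSel hoff K hK hodd h3 hH h2K (Cd • W.quadraticTwist (NumberField.discr K : ℚ)) ⟨Cd, rfl⟩ hLv Dt β ι d₁ M₀ hdiv hndiv)
  -- the twin is non-CM of analytic rank 0: `BSD₂(Wd)` from S1′
  have hcmd : ¬ (Cd • W.quadraticTwist (NumberField.discr K : ℚ)).HasCM := by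
    rw [hasCM_iff_of_j_eq (((W.quadraticTwist (NumberField.discr K : ℚ)).variableChange_j Cd).trans (W.j_quadraticTwist hD0))]
    exact hcm
  have hrd : (Cd • W.quadraticTwist (NumberField.discr K : ℚ)).analyticRank = 0 := by
    rw [analyticRank_smul]
    exact ((W.quadraticTwist (NumberField.discr K : ℚ)).analyticRank_eq_zero_iff_holds (hmod _)).mpr hLv
  have hBd : BSDp (Cd • W.quadraticTwist (NumberField.discr K : ℚ)) 2 := hS1 _ hcmd hrd
  exact swappedPairDescentAtTwo_shaDepth_anyTwin_of_facts hGZ hGZK hmod hMilneC W hr hSel K hK hodd h3 hH Dt hc0 β ι d₁ hy M₀ hdiv hndiv hsha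
    (Cd • W.quadraticTwist (NumberField.discr K : ℚ)) ⟨Cd, rfl⟩ hBd

/-! ## §2 The item by name from the items by name + PRINT×10 + the three research leaves (composition of record v2.14) -/

/-- ★ **CENSUS CERTIFICATE v2.14 — `MinimalTwinBSDTwo` (stmt-BirchSwinnertonDyer-22985) BY NAME from the six stubs of the skeleton of record.**
Hypotheses, in order: the four WALL row 1 items of route ByReductionTypeAtTwo BY NAME (stmt-19095–19098: rank-`0` BSD₂ by reduction type at `2`);
the ten PRINT named facts of v2.14 (GZ `GrossZagierAllLevels`, GZK `MultPublishedInputsAtTwo`, modularity `EntireLFunctionRat`, Milne `MilneAnyModel`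
— route items BY NAME — and `nonempty_modularParametrizationData`, Friedberg–Hoffstein, Abbes–Ullmo, Česnavičius, Mazur, `exists_isNewformOf`);
Q2 = item stmt-24880 `KolyvaginRelationAtTwo` BY NAME; and the three research leaves with their v2.14 texts VERBATIM — NVFROB (`hNVF`: per `W` on
the odd habitat cut ONE odd Heegner frame `K ≠ ℚ(√−3)` with `L(W^{(d_K)},1) ≠ 0`, no prime factor of `d_K` totally split in `ℚ(W[2])`, at most
`𝟙[Δ_W < 0]` transposition prime factors, and the door bit), WITNESS_{dc,≥2} (`hWit`: a transposition-deep Kolyvagin witness at every door-closed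
budget frame of exact depth `M₀ ≥ 2`) and KEX|off = DIV′|off (`hU`) ∧ NDIV′|off (`hL`).  CONCLUSION: the item's statement by name.
PROOF = the skeleton's composition: ON the cut `TwinAnnihilation.minimalTwinBSDTwo_onOddCut_of_wall_of_frobeniusFrameDoorSupply_of_witnessSupply_of_facts`
with its Manin clause (i) discharged by `OddManin.oddCutManinResidue_of_printedFacts` (closed crux stmt-22967 — PROVED AS TYPED, UDC-dependent,
(P†) pending: inherited); OFF the cut §1.  CONDITIONAL; three hypotheses are OPEN research statements; BSD is NOT proved; closes nothing.
[cite: GrossZagier1986, V.§2 (2.2)] [cite: Kolyvagin1989Izv, Thm. A] [cite: KrizLi2019, Def. 4.1, Thm. 4.3] [cite: WZhang2014, Thm. 1.1] -/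
theorem minimalTwinBSDTwo_of_wallItems_of_printFacts_of_kolyvaginRelation_of_leaves
    (hOrd : GoodOrdinaryRankZeroAtTwo) (hMult : MultiplicativeRankZeroAtTwo) (hSS : SupersingularRankZeroAtTwo) (hAdd : AdditiveRankZeroAtTwo)
    (hGZ : GrossZagierAllLevels) (hGZK : MultPublishedInputsAtTwo) (hmod : EntireLFunctionRat) (hMilneC : MilneAnyModel)
    (hMP : nonempty_modularParametrizationData) (hFH : friedbergHoffstein_exists_heegnerField_split_twist_ne_zero)
    (hAU : abbesUllmo_not_dvd_maninConstant_of_not_dvd_level) (hCes : cesnavicius_not_two_dvd_maninConstant_of_two_dvd_level)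
    (hMaz : mazur_not_dvd_maninConstant_of_odd) (hnf : exists_isNewformOf)
    (hQ2 : KolyvaginRelationAtTwo)
    (hNVF : ∀ (W : WeierstrassCurve ℚ) [W.IsElliptic] [W.IsGloballyMinimal] [NeZero (W.conductorNorm ℤ)],
      ¬ W.HasCM → W.analyticRank = 1 → Nat.card (W.selmerGroup 2) = 2 → Odd W.tamagawaProduct →
      (∀ n : ℕ, 0 < n → W.HasSurjectiveModNGaloisRep ((2 : ℤ) ^ n)) →
      (∃ v : IsDedekindDomain.HeightOneSpectrum (𝓞 ℚ), ((2 : ℕ) : 𝓞 ℚ) ∉ v.asIdeal ∧ ((W.conductorNorm ℤ : ℕ) : 𝓞 ℚ) ∈ v.asIdeal ∧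
        W.HasMultiplicativeReductionAt v) →
      ∃ (K : Type) (_ : Field K) (_ : NumberField K), IsImaginaryQuadratic K ∧ Odd (NumberField.discr K) ∧ NumberField.discr K ≠ -3 ∧
        SatisfiesHeegnerHypothesis (W.conductorNorm ℤ) K ∧ (W.quadraticTwist (NumberField.discr K : ℚ)).entireLFunction 1 ≠ 0 ∧
        (∀ q ∈ (NumberField.discr K).natAbs.primeFactors, ¬ (jacobiSym W.Δ.num q = 1 ∧ Even (W.frobeniusTrace q))) ∧
        ((NumberField.discr K).natAbs.primeFactors.filter (fun q ↦ jacobiSym W.Δ.num q = -1)).card ≤ (if W.Δ < 0 then 1 else 0) ∧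
        ∃ (_ : (W.quadraticTwist (NumberField.discr K : ℚ)).IsElliptic),
          (Nat.card ((W.quadraticTwist (NumberField.discr K : ℚ)).selmerGroup 2) ≠ 1 ∨
            ∀ (Dt : ModularParametrizationData W (W.conductorNorm ℤ)), Odd Dt.c → ∀ (β : ℤ) (ι : K →+* ℂ) (d₁ : KolyvaginHeegnerData Dt β ι 1),
              ¬ ∃ Q : (W.baseChange (ringClassField K ι 1)).toAffine.Point, (2 : ℤ) • Q = d₁.derivedPoint))
    (hWit : ∀ (W : WeierstrassCurve ℚ) [W.IsElliptic] [W.IsGloballyMinimal] [NeZero (W.conductorNorm ℤ)],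
      ¬ W.HasCM → W.analyticRank = 1 → Nat.card (W.selmerGroup 2) = 2 → Odd W.tamagawaProduct →
      (∀ n : ℕ, 0 < n → W.HasSurjectiveModNGaloisRep ((2 : ℤ) ^ n)) →
      (∃ v : IsDedekindDomain.HeightOneSpectrum (𝓞 ℚ), ((2 : ℕ) : 𝓞 ℚ) ∉ v.asIdeal ∧ ((W.conductorNorm ℤ : ℕ) : 𝓞 ℚ) ∈ v.asIdeal ∧
        W.HasMultiplicativeReductionAt v) →
      ∀ (K : Type) [Field K] [NumberField K], IsImaginaryQuadratic K → Odd (NumberField.discr K) → NumberField.discr K ≠ -3 →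
        SatisfiesHeegnerHypothesis (W.conductorNorm ℤ) K →
      ∀ (Dt : ModularParametrizationData W (W.conductorNorm ℤ)), Odd Dt.c →
      ∀ (β : ℤ) (ι : K →+* ℂ) (d₁ : KolyvaginHeegnerData Dt β ι 1), ¬ IsOfFinAddOrder d₁.derivedPoint →
      ∀ (M₀ : ℕ), (∃ Q : (W.baseChange (ringClassField K ι 1)).toAffine.Point, ((2 ^ M₀ : ℕ) : ℤ) • Q = d₁.derivedPoint) →
        (¬ ∃ Q : (W.baseChange (ringClassField K ι 1)).toAffine.Point, ((2 ^ (M₀ + 1) : ℕ) : ℤ) • Q = d₁.derivedPoint) → 2 ≤ M₀ →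
      ∀ (Wd : WeierstrassCurve ℚ) [Wd.IsElliptic] [Wd.IsGloballyMinimal],
        (∃ C : VariableChange ℚ, C • W.quadraticTwist (NumberField.discr K : ℚ) = Wd) →
        ((W.Δ < 0 ∧ padicValNat 2 Wd.tamagawaProduct ≤ 1) ∨ padicValNat 2 Wd.tamagawaProduct = 0) → Nat.card (Wd.selmerGroup 2) ≠ 1 →
        ∃ (n : ℕ) (d : KolyvaginHeegnerData Dt β ι n), Squarefree n ∧
          (∀ ℓ ∈ n.primeFactors, Zhang2014.IsKolyvaginPrime (W.conductorNorm ℤ) W K 2 ℓ ∧ 2 ≤ Zhang2014.kolyvaginIndex W 2 ℓ ∧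
            ∃ (v : IsDedekindDomain.HeightOneSpectrum (𝓞 ℚ))
              (𝔓 : Ideal (Literature.NumberTheory.GaloisRepresentations.absIntegers (𝓞 ℚ) ℚ)) (h : Field.absoluteGaloisGroup ℚ),
              ((ℓ : ℕ) : 𝓞 ℚ) ∈ v.asIdeal ∧ 𝔓 ∈ v.primesAbove ∧ IsArithFrobAt (𝓞 ℚ) h 𝔓 ∧ ∃ u : W.geomTorsion ((2 : ℕ) : ℤ), h • u ≠ u) ∧
          ¬ ∃ Q : (W.baseChange (ringClassField K ι n)).toAffine.Point, (2 : ℤ) • Q = d.derivedPoint)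
    (hU : ∀ (W : WeierstrassCurve ℚ) [W.IsElliptic] [W.IsGloballyMinimal] [NeZero (W.conductorNorm ℤ)],
      ¬ W.HasCM → W.analyticRank = 1 → Nat.card (W.selmerGroup 2) = 2 →
      ¬ (Odd W.tamagawaProduct ∧ (∀ n : ℕ, 0 < n → W.HasSurjectiveModNGaloisRep ((2 : ℤ) ^ n)) ∧
        ∃ v : IsDedekindDomain.HeightOneSpectrum (𝓞 ℚ), ((2 : ℕ) : 𝓞 ℚ) ∉ v.asIdeal ∧ ((W.conductorNorm ℤ : ℕ) : 𝓞 ℚ) ∈ v.asIdeal ∧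
          W.HasMultiplicativeReductionAt v) →
      ∀ (K : Type) [Field K] [NumberField K], IsImaginaryQuadratic K →
        Odd (NumberField.discr K) → NumberField.discr K ≠ -3 → SatisfiesHeegnerHypothesis (W.conductorNorm ℤ) K →
        ((Ideal.span {(2 : ℤ)}).primesOver (𝓞 K)).ncard = 2 →
        ∀ (Wd : WeierstrassCurve ℚ) [Wd.IsElliptic] [Wd.IsGloballyMinimal],
          (∃ C : VariableChange ℚ, C • W.quadraticTwist (NumberField.discr K : ℚ) = Wd) →
        (W.quadraticTwist (NumberField.discr K : ℚ)).entireLFunction 1 ≠ 0 →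
        ∀ (Dt : ModularParametrizationData W (W.conductorNorm ℤ)) (β : ℤ) (ι : K →+* ℂ) (d₁ : KolyvaginHeegnerData Dt β ι 1) (M₀ : ℕ),
          (∃ Q : (W.baseChange (ringClassField K ι 1)).toAffine.Point, ((2 ^ M₀ : ℕ) : ℤ) • Q = d₁.derivedPoint) →
          (¬ ∃ Q : (W.baseChange (ringClassField K ι 1)).toAffine.Point, ((2 ^ (M₀ + 1) : ℕ) : ℤ) • Q = d₁.derivedPoint) →
            Nat.card (AddCommGroup.primaryComponent (W.baseChange K).sha 2) *
                2 ^ (2 * (padicValInt 2 Dt.c + padicValNat 2 W.tamagawaProduct)) ∣ 2 ^ (2 * M₀))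
    (hL : ∀ (W : WeierstrassCurve ℚ) [W.IsElliptic] [W.IsGloballyMinimal] [NeZero (W.conductorNorm ℤ)],
      ¬ W.HasCM → W.analyticRank = 1 → Nat.card (W.selmerGroup 2) = 2 →
      ¬ (Odd W.tamagawaProduct ∧ (∀ n : ℕ, 0 < n → W.HasSurjectiveModNGaloisRep ((2 : ℤ) ^ n)) ∧
        ∃ v : IsDedekindDomain.HeightOneSpectrum (𝓞 ℚ), ((2 : ℕ) : 𝓞 ℚ) ∉ v.asIdeal ∧ ((W.conductorNorm ℤ : ℕ) : 𝓞 ℚ) ∈ v.asIdeal ∧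
          W.HasMultiplicativeReductionAt v) →
      ∀ (K : Type) [Field K] [NumberField K], IsImaginaryQuadratic K →
        Odd (NumberField.discr K) → NumberField.discr K ≠ -3 → SatisfiesHeegnerHypothesis (W.conductorNorm ℤ) K →
        ((Ideal.span {(2 : ℤ)}).primesOver (𝓞 K)).ncard = 2 →
        ∀ (Wd : WeierstrassCurve ℚ) [Wd.IsElliptic] [Wd.IsGloballyMinimal],
          (∃ C : VariableChange ℚ, C • W.quadraticTwist (NumberField.discr K : ℚ) = Wd) →
        (W.quadraticTwist (NumberField.discr K : ℚ)).entireLFunction 1 ≠ 0 →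
        ∀ (Dt : ModularParametrizationData W (W.conductorNorm ℤ)) (β : ℤ) (ι : K →+* ℂ) (d₁ : KolyvaginHeegnerData Dt β ι 1) (M₀ : ℕ),
          (∃ Q : (W.baseChange (ringClassField K ι 1)).toAffine.Point, ((2 ^ M₀ : ℕ) : ℤ) • Q = d₁.derivedPoint) →
          (¬ ∃ Q : (W.baseChange (ringClassField K ι 1)).toAffine.Point, ((2 ^ (M₀ + 1) : ℕ) : ℤ) • Q = d₁.derivedPoint) →
            2 ^ (2 * M₀) ∣ Nat.card (AddCommGroup.primaryComponent (W.baseChange K).sha 2) *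
                2 ^ (2 * (padicValInt 2 Dt.c + padicValNat 2 W.tamagawaProduct))) :
    MinimalTwinBSDTwo := by
  -- S1′ from the four WALL row 1 items (case split on the reduction type at `2`)
  have hS1 : ∀ (W : WeierstrassCurve ℚ) [W.IsElliptic] [W.IsGloballyMinimal], ¬ W.HasCM → W.analyticRank = 0 → BSDp W 2 := by
    intro W _ _ hCM hr
    by_cases hg : W.HasGoodReductionAtPrime 2
    · by_cases hd : ((2 : ℕ) : ℤ) ∣ W.frobeniusTrace 2
      · exact hSS W hCM hr ⟨hg, hd⟩
      · exact hOrd W hCM hr ⟨hg, hd⟩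
    · by_cases hm : W.HasMultiplicativeReductionAtPrime 2
      · exact hMult W hCM hr hm
      · exact hAdd W hCM hr ⟨hg, hm⟩
  -- MANIN|₄ derived from PRINT (closed crux 22967 + the odd-isogeny transport)
  have hMan := OddManin.oddCutManinResidue_of_printedFacts hMaz hAU hCes hnf hMP
  intro W _ _ hcm hr hSel
  by_cases hcut : Odd W.tamagawaProduct ∧ (∀ n : ℕ, 0 < n → W.HasSurjectiveModNGaloisRep ((2 : ℤ) ^ n)) ∧
      ∃ v : IsDedekindDomain.HeightOneSpectrum (𝓞 ℚ), ((2 : ℕ) : 𝓞 ℚ) ∉ v.asIdeal ∧ ((W.conductorNorm ℤ : ℕ) : 𝓞 ℚ) ∈ v.asIdeal ∧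
        W.HasMultiplicativeReductionAt v
  · -- ON the cut: p818537 §2 with clause (i) supplied by `hMan` and (ii) by NVFROB
    haveI : NeZero (W.conductorNorm ℤ) := ⟨(W.conductorNorm_pos_holds).ne'⟩
    obtain ⟨hT, hρ, hv⟩ := hcut
    refine minimalTwinBSDTwo_onOddCut_of_wall_of_frobeniusFrameDoorSupply_of_witnessSupply_of_facts hQ2 hGZ hGZK hmod hMilneC hMP hAU hCes
      hS1 ?_ hWit W hcm hr hSel hT hρ hv
    intro V _ _ _ hcmV hrV hSelV hTV hρV hvV
    exact ⟨hMan V hcmV hrV hSelV hTV hρV hvV, hNVF V hcmV hrV hSelV hTV hρV hvV⟩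
  · -- OFF the cut: §1
    exact bsdp_offCut_of_rankZero_of_halves_of_facts hS1 hU hL hGZ hGZK hmod hMilneC hMP hFH W hcm hr hSel hcut

/-! ## §3 KEX|off is U₂-necessary (no overreach in the off-cut leaf) -/

/-- **KEX|off ⟸ PRINT×4 + S1′ + U₂.**  Granted GZ, GZK, modularity and Milne, rank-`0` BSD₂ for every non-CM globally minimal curve (S1′ = WALL row 1)
and the item `MinimalTwinBSDTwo` itself, BOTH off-cut halves DIV′|off and NDIV′|off of v2.14 hold (texts VERBATIM): at the given frame
`AnalyticTwin.kexAny_of_minimalTwinBSDTwo_of_wall_of_facts` produces SOME exact `2`-depth `M₁` of `P(1)` with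
`#Ш(W/K)[2^∞]·2^{2(v₂ c + v₂ C(W))} = 2^{2M₁}`, and the exact `2`-depth is unique (`M₁ = M₀`).  Hence the off-cut leaf KEX|off is NOT stronger than
the crux modulo WALL row 1 + PRINT (the `¬ OnOddHabitatCut` binder is idle here: the relation holds at every frame).  CONDITIONAL; BSD is NOT proved.
[cite: GrossZagier1986, V.§2 (2.2)] [cite: Milne1972ArithmeticAV, §1 Thm. 1] -/
theorem heegnerIndexOffCut_of_minimalTwinBSDTwo_of_rankZero_of_facts
    (hGZ : GrossZagierAllLevels) (hGZK : MultPublishedInputsAtTwo) (hmod : EntireLFunctionRat) (hMilneC : MilneAnyModel)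
    (hS1 : ∀ (W : WeierstrassCurve ℚ) [W.IsElliptic] [W.IsGloballyMinimal], ¬ W.HasCM → W.analyticRank = 0 → BSDp W 2)
    (hTw : MinimalTwinBSDTwo) :
    (∀ (W : WeierstrassCurve ℚ) [W.IsElliptic] [W.IsGloballyMinimal] [NeZero (W.conductorNorm ℤ)],
      ¬ W.HasCM → W.analyticRank = 1 → Nat.card (W.selmerGroup 2) = 2 →
      ¬ (Odd W.tamagawaProduct ∧ (∀ n : ℕ, 0 < n → W.HasSurjectiveModNGaloisRep ((2 : ℤ) ^ n)) ∧
        ∃ v : IsDedekindDomain.HeightOneSpectrum (𝓞 ℚ), ((2 : ℕ) : 𝓞 ℚ) ∉ v.asIdeal ∧ ((W.conductorNorm ℤ : ℕ) : 𝓞 ℚ) ∈ v.asIdeal ∧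
          W.HasMultiplicativeReductionAt v) →
      ∀ (K : Type) [Field K] [NumberField K], IsImaginaryQuadratic K →
        Odd (NumberField.discr K) → NumberField.discr K ≠ -3 → SatisfiesHeegnerHypothesis (W.conductorNorm ℤ) K →
        ((Ideal.span {(2 : ℤ)}).primesOver (𝓞 K)).ncard = 2 →
        ∀ (Wd : WeierstrassCurve ℚ) [Wd.IsElliptic] [Wd.IsGloballyMinimal],
          (∃ C : VariableChange ℚ, C • W.quadraticTwist (NumberField.discr K : ℚ) = Wd) →
        (W.quadraticTwist (NumberField.discr K : ℚ)).entireLFunction 1 ≠ 0 →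
        ∀ (Dt : ModularParametrizationData W (W.conductorNorm ℤ)) (β : ℤ) (ι : K →+* ℂ) (d₁ : KolyvaginHeegnerData Dt β ι 1) (M₀ : ℕ),
          (∃ Q : (W.baseChange (ringClassField K ι 1)).toAffine.Point, ((2 ^ M₀ : ℕ) : ℤ) • Q = d₁.derivedPoint) →
          (¬ ∃ Q : (W.baseChange (ringClassField K ι 1)).toAffine.Point, ((2 ^ (M₀ + 1) : ℕ) : ℤ) • Q = d₁.derivedPoint) →
            Nat.card (AddCommGroup.primaryComponent (W.baseChange K).sha 2) *
                2 ^ (2 * (padicValInt 2 Dt.c + padicValNat 2 W.tamagawaProduct)) ∣ 2 ^ (2 * M₀)) ∧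
    (∀ (W : WeierstrassCurve ℚ) [W.IsElliptic] [W.IsGloballyMinimal] [NeZero (W.conductorNorm ℤ)],
      ¬ W.HasCM → W.analyticRank = 1 → Nat.card (W.selmerGroup 2) = 2 →
      ¬ (Odd W.tamagawaProduct ∧ (∀ n : ℕ, 0 < n → W.HasSurjectiveModNGaloisRep ((2 : ℤ) ^ n)) ∧
        ∃ v : IsDedekindDomain.HeightOneSpectrum (𝓞 ℚ), ((2 : ℕ) : 𝓞 ℚ) ∉ v.asIdeal ∧ ((W.conductorNorm ℤ : ℕ) : 𝓞 ℚ) ∈ v.asIdeal ∧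
          W.HasMultiplicativeReductionAt v) →
      ∀ (K : Type) [Field K] [NumberField K], IsImaginaryQuadratic K →
        Odd (NumberField.discr K) → NumberField.discr K ≠ -3 → SatisfiesHeegnerHypothesis (W.conductorNorm ℤ) K →
        ((Ideal.span {(2 : ℤ)}).primesOver (𝓞 K)).ncard = 2 →
        ∀ (Wd : WeierstrassCurve ℚ) [Wd.IsElliptic] [Wd.IsGloballyMinimal],
          (∃ C : VariableChange ℚ, C • W.quadraticTwist (NumberField.discr K : ℚ) = Wd) →
        (W.quadraticTwist (NumberField.discr K : ℚ)).entireLFunction 1 ≠ 0 →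
        ∀ (Dt : ModularParametrizationData W (W.conductorNorm ℤ)) (β : ℤ) (ι : K →+* ℂ) (d₁ : KolyvaginHeegnerData Dt β ι 1) (M₀ : ℕ),
          (∃ Q : (W.baseChange (ringClassField K ι 1)).toAffine.Point, ((2 ^ M₀ : ℕ) : ℤ) • Q = d₁.derivedPoint) →
          (¬ ∃ Q : (W.baseChange (ringClassField K ι 1)).toAffine.Point, ((2 ^ (M₀ + 1) : ℕ) : ℤ) • Q = d₁.derivedPoint) →
            2 ^ (2 * M₀) ∣ Nat.card (AddCommGroup.primaryComponent (W.baseChange K).sha 2) *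
                2 ^ (2 * (padicValInt 2 Dt.c + padicValNat 2 W.tamagawaProduct))) := by
  -- the exact relation at every frame, at SOME exact depth `M₁`
  have hex := kexAny_of_minimalTwinBSDTwo_of_wall_of_facts hGZ hGZK hmod hMilneC hS1 hTw
  -- uniqueness of the exact `2`-depth: `2^{M} ∣ y ∧ 2^{M+1} ∤ y` pins `M`
  have huniq : ∀ {A : Type} [AddCommGroup A] (y : A) (M M' : ℕ),
      (∃ Q : A, ((2 ^ M : ℕ) : ℤ) • Q = y) → (¬ ∃ Q : A, ((2 ^ (M + 1) : ℕ) : ℤ) • Q = y) →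
      (∃ Q : A, ((2 ^ M' : ℕ) : ℤ) • Q = y) → (¬ ∃ Q : A, ((2 ^ (M' + 1) : ℕ) : ℤ) • Q = y) → M = M' := by
    intro A _ y M M' hd hnd hd' hnd'
    -- from `2^M Q = y` every smaller-or-equal power divides; if `M' + 1 ≤ M` then `2^{M'+1} ∣ y`, contradiction; symmetric
    have key : ∀ (a b : ℕ), (∃ Q : A, ((2 ^ a : ℕ) : ℤ) • Q = y) → (¬ ∃ Q : A, ((2 ^ (b + 1) : ℕ) : ℤ) • Q = y) → a ≤ b := by
      intro a b ⟨Q, hQ⟩ hnb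
      by_contra hlt
      obtain ⟨k, hk⟩ : ∃ k, a = b + 1 + k := ⟨a - (b + 1), by omega⟩
      exact hnb ⟨((2 ^ k : ℕ) : ℤ) • Q, by rw [smul_smul, ← hQ, hk]; congr 1; push_cast; ring⟩
    exact le_antisymm (key M M' hd hnd') (key M' M hd' hnd)
  refine ⟨?_, ?_⟩
  · intro W _ _ _ hcm hr hSel _hoff K _ _ hK hodd h3 hH h2K Wd _ _ hWd hLv Dt β ι d₁ M₀ hdiv hndiv
    obtain ⟨M₁, hdiv₁, hndiv₁, hsha⟩ := hex W hcm hr hSel K hK hodd h3 hH h2K Wd hWd hLv Dt β ι d₁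
    obtain rfl : M₀ = M₁ := huniq _ M₀ M₁ hdiv hndiv hdiv₁ hndiv₁
    exact hsha.symm ▸ dvd_refl _
  · intro W _ _ _ hcm hr hSel _hoff K _ _ hK hodd h3 hH h2K Wd _ _ hWd hLv Dt β ι d₁ M₀ hdiv hndiv
    obtain ⟨M₁, hdiv₁, hndiv₁, hsha⟩ := hex W hcm hr hSel K hK hodd h3 hH h2K Wd hWd hLv Dt β ι d₁
    obtain rfl : M₀ = M₁ := huniq _ M₀ M₁ hdiv hndiv hdiv₁ hndiv₁
    exact hsha ▸ dvd_refl _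

end Summit.BirchSwinnertonDyer.BirchSwinnertonDyer.Theorems.GenusExact.TwinSwap.FreezeCensus

end
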